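import Summits.QuantumFields.YangMills.Theorems.AllWindowsColdBoxBoxHighLineLandauBallQuaternion
import Summits.QuantumFields.YangMills.Theorems.LuscherReductionOneSiteLevelsQuatPullback

/-!
# TASK T-S5/U5 step (1), T-S5.3a `GaugeLinkStep` and T-S5.3 `OrbitLocalisation` (orbit localisation), PROVED

Planner ym-idea-2 g17's typed task `Cruxes/BoxWindowHighSU2213/TaskS5Orbit.lean` (commit 4abfb8beda02, sha12 f8b6661d48a6) — the
deterministic half of step (1) of the XL comparison stubs S5 (LINE-19 ⟨stmt-QuantumFields-24004⟩/⟨24335⟩, `stub_landauSecondOrder`) and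
U5 (LINE-20 ⟨24336⟩, `stub_landauThirdOrder`).  The task's objects and Props are copied here VERBATIM (a `Cruxes/` file is not importable
from `Theorems/`): `gaugeDist`, `GaugeLinkStep` (T-S5.3a), `OrbitLocalisation` (T-S5.3), and its sanity lemma `gaugeDist_of_not_mem`.

Proved here: **`gaugeLinkStep : GaugeLinkStep`** and **`orbitLocalisation : OrbitLocalisation`** — if two INTERIOR gauge transformations
`g, g'` both put `U` in the defect ball of radius `r` on every box link, then `gaugeDist g g' x = 2 − Re tr (g'_x g_x⁻¹) ≤ 16 r² H²` at
every site; no smallness hypothesis.  The metric is the quaternion one (the planner's hint): `q = su2Quat : SU(2) → ℍ` of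
`Literature…SU2Haar` is multiplicative with `‖q‖ = 1` and `2 − Re tr V = ‖q(V) − 1‖²` (✓`LandauBall.linkDefect_eq_norm_sq`, i.e. the tree's
`su2Deficit_eq_norm_sub_sq`), so everything is the triangle inequality in the normed division ring `ℍ`:
* `rel_eq` — with `h := g'·g⁻¹`, along a box edge `e = (y, μ)`: `h_y = U^{g'}(e) · h_{y+e_μ} · U^{g}(e)⁻¹` (a group identity), whence
  `‖q(h_y) − q(h_{y+e_μ})‖ ≤ ‖q(U^{g'} e) − 1‖ + ‖q(U^{g} e) − 1‖ ≤ r + r` (`norm_su2Quat_rel_sub_rel_le`); T-S5.3a follows because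
  `2 − Re tr (h_y h_{y+e_μ}⁻¹) = ‖q(h_y) q(h_{y+e_μ})⋆ − 1‖² = ‖q(h_y) − q(h_{y+e_μ})‖²`;
* `norm_su2Quat_rel_sub_one_le_coord` — `h = 1` on the wall `x₀ = 0` (both transformations are interior), and telescoping along the
  straight box path `(0, x₁, x₂, x₃) → x` (`x₀ ≤ 2H − 1` box edges for interior `x`) gives `‖q(h_x) − 1‖ ≤ 2r·x₀ ≤ 2r(2H − 1)`, so
  `gaugeDist g g' x ≤ 4r²(2H − 1)² ≤ 16 r² H²`; off the interior `gaugeDist = 0`.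

Mathlib + tree only (`su2Quat_one` is the tree's, ✓`…LuscherReductionOneSiteLevelsQuatPullback`); the only definitions are the task's (verbatim);
standard axioms.  HONEST LABEL: the deterministic helper of step (1)
of the XL stubs S5/U5 (T-S5.4, the Laplace asymptotics of the orbit average, is the analytic part and is NOT touched); S5, U5 and the cruxes
⟨24004⟩ ⟨24335⟩ ⟨24336⟩ remain OPEN; no summit is proved; the Yang–Mills mass gap is NOT proved by this file.  Seat ym-line-sfw-p2-w5 g21.
-/

set_option autoImplicit false

noncomputable section

open Matrix Quaternion
open Literature.MathematicalPhysics.QuantumFieldTheory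
open Literature.MathematicalPhysics.QuantumFieldTheory.AxialGauge
open Literature.MathematicalPhysics.QuantumLattice
open Summit.QuantumFields.YangMills.Theorems.AllWindowsColdBoxBoxHighLine.LandauBall (su2Quat_mul_mul_inv linkDefect_eq_norm_sq
  norm_su2Quat_sub_one_le)
open Summit.QuantumFields.YangMills.Theorems.FemtoTransferGap (su2Quat_one)

namespace Summit.QuantumFields.YangMills.Theorems.AllWindowsColdBoxBoxHighLine

/-! ## The task's objects (verbatim from `TaskS5Orbit.lean`) -/

/-- Gauge distance at a site, in the `linkDefect` normalisation: `2 − Re tr (g' x · (g x)⁻¹) = ½‖g'_x − g_x‖_F²`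
(`= |a' − a|²` for the unit quaternions `a, a'` of `g x, g' x`). -/
def gaugeDist (g g' : Literature.Probability.LatticeModels.Site 4 → SU2) (x : Literature.Probability.LatticeModels.Site 4) : ℝ :=
  2 - (((g' x * (g x)⁻¹ : SU2) : Matrix (Fin 2) (Fin 2) ℂ).trace).re

/-- T-S5.3a **(one-link step; S)**: if `U^g` and `U^{g'}` both have defect `≤ r²` on the link `e = (x, μ)`, then the relative gauge
`h = g'·g⁻¹` moves by at most `2√2·r` in Frobenius norm across `e`, i.e. `½‖h_x − h_{x+μ}‖_F² ≤ 4 r²`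
(`h_x h_{x+μ}⁻¹ − 1 = (h_x V_e h_{x+μ}⁻¹ − 1) + h_x (1 − V_e) h_{x+μ}⁻¹` with `V = U^g`, `V^h = U^{g'}`, unitary invariance of `‖·‖_F`). -/
def GaugeLinkStep : Prop :=
  ∀ r : ℝ, 0 ≤ r → ∀ U : LGConfig 4 SU2, ∀ g g' : Literature.Probability.LatticeModels.Site 4 → SU2,
    ∀ e : Literature.MathematicalPhysics.QuantumLattice.ZdEdge 4,
      linkDefect (gaugeTransformZd g U) e ≤ r ^ 2 → linkDefect (gaugeTransformZd g' U) e ≤ r ^ 2 →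
        2 - ((((g' e.1 * (g e.1)⁻¹) * (g' (e.1 + Pi.single e.2 1) * (g (e.1 + Pi.single e.2 1))⁻¹)⁻¹ : SU2) :
              Matrix (Fin 2) (Fin 2) ℂ).trace).re ≤ 4 * r ^ 2

/-- T-S5.3 **(orbit localisation; S–M)**: two INTERIOR gauge transformations that both put `U` in the defect ball of radius `r` on every
box link differ by at most `16 r² H²` in gauge distance at every site (telescoping T-S5.3a along the straight path
`(0, x₁, x₂, x₃) → x` of `< 2H` box links, at whose start `g = g' = 1`).  No smallness hypothesis is needed. -/
def OrbitLocalisation : Prop :=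
  ∀ H : ℕ, ∀ r : ℝ, 0 ≤ r → ∀ U : LGConfig 4 SU2, ∀ g g' : Literature.Probability.LatticeModels.Site 4 → SU2,
    IsInteriorGauge H g → IsInteriorGauge H g' →
    (∀ e ∈ boxEdges 4 (2 * H + 1), linkDefect (gaugeTransformZd g U) e ≤ r ^ 2) →
    (∀ e ∈ boxEdges 4 (2 * H + 1), linkDefect (gaugeTransformZd g' U) e ≤ r ^ 2) →
      ∀ x, gaugeDist g g' x ≤ 16 * r ^ 2 * (H : ℝ) ^ 2

/-- Sanity (definitional): off the interior both transformations are `1`, so the gauge distance vanishes there. -/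
theorem gaugeDist_of_not_mem (H : ℕ) (g g' : Literature.Probability.LatticeModels.Site 4 → SU2)
    (hg : IsInteriorGauge H g) (hg' : IsInteriorGauge H g') (x : Literature.Probability.LatticeModels.Site 4)
    (hx : x ∉ interiorSites H) : gaugeDist g g' x = 0 := by
  simp [gaugeDist, hg x hx, hg' x hx, Matrix.trace_one]

/-! ## Quaternion bookkeeping -/

namespace SmearedFPOrbit

open Literature.Probability.LatticeModels (Site)

/-- `q(A B⁻¹) = q(A) q(B)⋆`. -/
theorem su2Quat_mul_inv (A B : SU2) : su2Quat (A * B⁻¹) = su2Quat A * star (su2Quat B) := by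
  have h := su2Quat_mul_mul_inv A 1 B
  rwa [mul_one, su2Quat_one, mul_one] at h

/-- A unit quaternion times its conjugate is `1`. -/
theorem su2Quat_mul_star (B : SU2) : su2Quat B * star (su2Quat B) = 1 := by
  rw [Quaternion.self_mul_star, normSq_eq_norm_mul_self, norm_su2Quat, mul_one, Quaternion.coe_one]

/-- The deficit of a quotient is the squared quaternion distance: `2 − Re tr (A B⁻¹) = ‖q(A) − q(B)‖²`. -/
theorem deficit_mul_inv_eq_norm_sub_sq (A B : SU2) :
    2 - (((A * B⁻¹ : SU2) : Matrix (Fin 2) (Fin 2) ℂ).trace).re = ‖su2Quat A - su2Quat B‖ ^ 2 := by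
  have hd : 2 - (((A * B⁻¹ : SU2) : Matrix (Fin 2) (Fin 2) ℂ).trace).re = ‖su2Quat (A * B⁻¹) - 1‖ ^ 2 :=
    linkDefect_eq_norm_sq (fun _ => A * B⁻¹) ((0 : Site 4), (0 : Fin 4))
  have hq : su2Quat (A * B⁻¹) - 1 = (su2Quat A - su2Quat B) * star (su2Quat B) := by
    rw [su2Quat_mul_inv, sub_mul, su2Quat_mul_star]
  rw [hd, hq, norm_mul, norm_star, norm_su2Quat, mul_one]

/-- **The relative transformation along an edge** (a group identity): with `h := g' · g⁻¹` and `e = (y, μ)`,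
`h_y = U^{g'}(e) · h_{y + e_μ} · U^{g}(e)⁻¹`. -/
theorem rel_eq (g' g : Site 4 → SU2) (U : LGConfig 4 SU2) (e : Literature.MathematicalPhysics.QuantumLattice.ZdEdge 4) :
    g' e.1 * (g e.1)⁻¹ =
      gaugeTransformZd g' U e * (g' (e.1 + Pi.single e.2 1) * (g (e.1 + Pi.single e.2 1))⁻¹) * (gaugeTransformZd g U e)⁻¹ := by
  simp only [gaugeTransformZd]
  group

/-- For quaternions `v, b, c` with `‖b‖ = ‖c‖ = 1`: `‖v c b⋆ − c‖ ≤ ‖v − 1‖ + ‖b − 1‖`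
(`v c b⋆ − c = (v − 1)(c b⋆) + c (b⋆ − 1)`, multiplicative norm, `‖b⋆ − 1‖ = ‖b − 1‖`). -/
theorem norm_mul_mul_star_sub_le {v b c : ℍ} (hb : ‖b‖ = 1) (hc : ‖c‖ = 1) :
    ‖v * c * star b - c‖ ≤ ‖v - 1‖ + ‖b - 1‖ := by
  have h : v * c * star b - c = (v - 1) * (c * star b) + c * (star b - 1) := by noncomm_ring
  have hs : star b - 1 = star (b - 1) := by rw [star_sub, star_one]
  calc ‖v * c * star b - c‖ = ‖(v - 1) * (c * star b) + c * (star b - 1)‖ := by rw [h]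
    _ ≤ ‖(v - 1) * (c * star b)‖ + ‖c * (star b - 1)‖ := norm_add_le _ _
    _ = ‖v - 1‖ + ‖b - 1‖ := by rw [norm_mul, norm_mul, norm_mul, hs, norm_star, norm_star, hb, hc, mul_one, mul_one, one_mul]

/-! ## One edge -/

/-- **Per-edge step.**  If the link `e` has defect `≤ r₀²` for `U^{g}` and `≤ r₁²` for `U^{g'}`, then the relative transformation
`h = g' g⁻¹` satisfies `‖q(h_y) − q(h_{y+e_μ})‖ ≤ r₁ + r₀` across `e = (y, μ)`. -/
theorem norm_su2Quat_rel_sub_rel_le {r₀ r₁ : ℝ} (hr₀ : 0 ≤ r₀) (hr₁ : 0 ≤ r₁) {U : LGConfig 4 SU2} {g g' : Site 4 → SU2}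
    {e : Literature.MathematicalPhysics.QuantumLattice.ZdEdge 4} (h₀ : linkDefect (gaugeTransformZd g U) e ≤ r₀ ^ 2) (h₁ : linkDefect (gaugeTransformZd g' U) e ≤ r₁ ^ 2) :
    ‖su2Quat (g' e.1 * (g e.1)⁻¹) - su2Quat (g' (e.1 + Pi.single e.2 1) * (g (e.1 + Pi.single e.2 1))⁻¹)‖ ≤ r₁ + r₀ := by
  rw [rel_eq g' g U e, su2Quat_mul_mul_inv]
  have hb : ‖su2Quat (gaugeTransformZd g U e)‖ = 1 := norm_su2Quat _
  have hc : ‖su2Quat (g' (e.1 + Pi.single e.2 1) * (g (e.1 + Pi.single e.2 1))⁻¹)‖ = 1 := norm_su2Quat _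
  have hv : ‖su2Quat (gaugeTransformZd g' U e) - 1‖ ≤ r₁ := norm_su2Quat_sub_one_le hr₁ h₁
  have hb' : ‖su2Quat (gaugeTransformZd g U e) - 1‖ ≤ r₀ := norm_su2Quat_sub_one_le hr₀ h₀
  calc _ ≤ ‖su2Quat (gaugeTransformZd g' U e) - 1‖ + ‖su2Quat (gaugeTransformZd g U e) - 1‖ :=
        norm_mul_mul_star_sub_le hb hc
    _ ≤ r₁ + r₀ := add_le_add hv hb'

/-! ## Telescoping to the cold wall -/

/-- **Telescoping along the time axis.**  For interior `g, g'` with the two defect bounds on every box link, a site `x` of the cube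
`[0, 2H]⁴` with `x₀ = n ≤ 2H − 1` has `‖q(g'_x g_x⁻¹) − 1‖ ≤ (r₁ + r₀) n`: induction on `n`, the base being the wall `x₀ = 0` where both
transformations are the identity, the step the per-edge estimate across the box edge `(x − e₀, 0)`. -/
theorem norm_su2Quat_rel_sub_one_le_coord {H : ℕ} {r₀ r₁ : ℝ} (hr₀ : 0 ≤ r₀) (hr₁ : 0 ≤ r₁) {U : LGConfig 4 SU2}
    {g g' : Site 4 → SU2} (hg : IsInteriorGauge H g) (hg' : IsInteriorGauge H g')
    (h₀ : ∀ e ∈ boxEdges 4 (2 * H + 1), linkDefect (gaugeTransformZd g U) e ≤ r₀ ^ 2)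
    (h₁ : ∀ e ∈ boxEdges 4 (2 * H + 1), linkDefect (gaugeTransformZd g' U) e ≤ r₁ ^ 2) :
    ∀ (n : ℕ) (x : Site 4), x 0 = n → (∀ k, 0 ≤ x k ∧ x k ≤ 2 * (H : ℤ)) → (n : ℤ) ≤ 2 * (H : ℤ) - 1 →
      ‖su2Quat (g' x * (g x)⁻¹) - 1‖ ≤ (r₁ + r₀) * n := by
  intro n
  induction n with
  | zero =>
    intro x hx0 _ _
    have hx : x ∉ interiorSites H := by
      simp only [interiorSites, Fintype.mem_piFinset, Finset.mem_Icc, not_forall, not_and, not_le]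
      exact ⟨0, fun h => by omega⟩
    rw [hg x hx, hg' x hx, inv_one, mul_one, su2Quat_one, sub_self, norm_zero]
    simp
  | succ n ih =>
    intro x hx0 hbox hn
    -- the previous site on the time axis and the box edge joining it to `x`
    set y : Site 4 := x - Pi.single 0 1 with hy
    have hy0 : y 0 = n := by
      simp only [hy, Pi.sub_apply, Pi.single_eq_same]; omega
    have hyk : ∀ k, k ≠ 0 → y k = x k := fun k hk => by
      simp only [hy, Pi.sub_apply, Pi.single_apply, hk, if_false, sub_zero]
    have hybox : ∀ k, 0 ≤ y k ∧ y k ≤ 2 * (H : ℤ) := by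
      intro k
      by_cases hk : k = 0
      · subst hk; rw [hy0]; constructor <;> omega
      · rw [hyk k hk]; exact hbox k
    have hyx : y + Pi.single 0 1 = x := by rw [hy, sub_add_cancel]
    have he : (y, (0 : Fin 4)) ∈ boxEdges 4 (2 * H + 1) := by
      rw [mem_boxEdges_iff]
      refine ⟨fun k => ⟨(hybox k).1, ?_⟩, ?_⟩
      · have := (hybox k).2; push_cast; omega
      · rw [hy0]; push_cast; omega
    have hstep := norm_su2Quat_rel_sub_rel_le hr₀ hr₁ (h₀ _ he) (h₁ _ he)
    simp only [hyx] at hstep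
    have hih := ih y hy0 hybox (by push_cast at hn ⊢; omega)
    calc ‖su2Quat (g' x * (g x)⁻¹) - 1‖
        ≤ ‖su2Quat (g' x * (g x)⁻¹) - su2Quat (g' y * (g y)⁻¹)‖ + ‖su2Quat (g' y * (g y)⁻¹) - 1‖ :=
          norm_sub_le_norm_sub_add_norm_sub _ _ _
      _ ≤ (r₁ + r₀) + (r₁ + r₀) * n := add_le_add (by rw [norm_sub_rev]; exact hstep) hih
      _ = (r₁ + r₀) * (n + 1 : ℕ) := by push_cast; ring

/-- **Orbit localisation in quaternion norm**: for interior `g, g'` in the two defect balls (radii `r₀, r₁`) on every box link,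
`‖q(g'_x g_x⁻¹) − 1‖ ≤ (r₁ + r₀)(2H − 1)` at every INTERIOR site (and `= 0` elsewhere). -/
theorem norm_su2Quat_rel_sub_one_le {H : ℕ} {r₀ r₁ : ℝ} (hr₀ : 0 ≤ r₀) (hr₁ : 0 ≤ r₁) {U : LGConfig 4 SU2}
    {g g' : Site 4 → SU2} (hg : IsInteriorGauge H g) (hg' : IsInteriorGauge H g')
    (h₀ : ∀ e ∈ boxEdges 4 (2 * H + 1), linkDefect (gaugeTransformZd g U) e ≤ r₀ ^ 2)
    (h₁ : ∀ e ∈ boxEdges 4 (2 * H + 1), linkDefect (gaugeTransformZd g' U) e ≤ r₁ ^ 2) {x : Site 4}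
    (hx : x ∈ interiorSites H) : ‖su2Quat (g' x * (g x)⁻¹) - 1‖ ≤ (r₁ + r₀) * (2 * H - 1) := by
  have hxI : ∀ k, 1 ≤ x k ∧ x k ≤ 2 * (H : ℤ) - 1 := by
    simpa only [interiorSites, Fintype.mem_piFinset, Finset.mem_Icc] using hx
  have hx0 : 0 ≤ x 0 := by have := (hxI 0).1; omega
  have key := norm_su2Quat_rel_sub_one_le_coord hr₀ hr₁ hg hg' h₀ h₁ (x 0).toNat x (Int.toNat_of_nonneg hx0).symm
    (fun k => ⟨by have := (hxI k).1; omega, by have := (hxI k).2; omega⟩)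
    (by rw [Int.toNat_of_nonneg hx0]; exact (hxI 0).2)
  have hn : ((x 0).toNat : ℝ) ≤ 2 * H - 1 := by
    have h2 : ((x 0).toNat : ℤ) ≤ 2 * (H : ℤ) - 1 := by rw [Int.toNat_of_nonneg hx0]; exact (hxI 0).2
    exact_mod_cast h2
  exact key.trans (mul_le_mul_of_nonneg_left hn (by positivity))

end SmearedFPOrbit

/-! ## T-S5.3a and T-S5.3 by name -/

open SmearedFPOrbit in
/-- **T-S5.3a: the one-link step.**  `2 − Re tr (h_x h_{x+μ}⁻¹) = ‖q(h_x) − q(h_{x+μ})‖² ≤ (r + r)² = 4r²` for `h = g'·g⁻¹`. -/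
theorem gaugeLinkStep : GaugeLinkStep := by
  intro r hr U g g' e hg hg'
  rw [deficit_mul_inv_eq_norm_sub_sq]
  have h := norm_su2Quat_rel_sub_rel_le hr hr hg hg'
  have h2 : ‖su2Quat (g' e.1 * (g e.1)⁻¹) - su2Quat (g' (e.1 + Pi.single e.2 1) * (g (e.1 + Pi.single e.2 1))⁻¹)‖ ^ 2
      ≤ (r + r) ^ 2 := pow_le_pow_left₀ (norm_nonneg _) h 2
  linarith

open SmearedFPOrbit in
/-- **T-S5.3: orbit localisation.**  `gaugeDist g g' x = ‖q(g'_x) − q(g_x)‖² = ‖q(g'_x g_x⁻¹) − 1‖² ≤ (2r(2H − 1))² ≤ 16 r² H²` at interior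
sites, and `gaugeDist g g' x = 0` off the interior. -/
theorem orbitLocalisation : OrbitLocalisation := by
  intro H r hr U g g' hg hg' h h' x
  by_cases hx : x ∈ interiorSites H
  · have key := norm_su2Quat_rel_sub_one_le hr hr hg hg' h h' hx
    have hH : (1 : ℝ) ≤ 2 * H - 1 := by
      have hxI : ∀ k, 1 ≤ x k ∧ x k ≤ 2 * (H : ℤ) - 1 := by
        simpa only [interiorSites, Fintype.mem_piFinset, Finset.mem_Icc] using hx
      have : (1 : ℤ) ≤ 2 * (H : ℤ) - 1 := (hxI 0).1.trans (hxI 0).2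
      exact_mod_cast this
    have hd : gaugeDist g g' x = ‖su2Quat (g' x * (g x)⁻¹) - 1‖ ^ 2 :=
      linkDefect_eq_norm_sq (fun _ => g' x * (g x)⁻¹) ((0 : Literature.Probability.LatticeModels.Site 4), (0 : Fin 4))
    rw [hd]
    have h2 : ‖su2Quat (g' x * (g x)⁻¹) - 1‖ ^ 2 ≤ ((r + r) * (2 * H - 1)) ^ 2 := pow_le_pow_left₀ (norm_nonneg _) key 2
    nlinarith
  · rw [gaugeDist_of_not_mem H g g' hg hg' x hx]
    positivity

end Summit.QuantumFields.YangMills.Theorems.AllWindowsColdBoxBoxHighLine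

end
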